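import Summits.AtomisticToContinuum.Crystallization.Theorems.PerronTransitivityNoFractionalGainTransitiveCrystals
import Summits.AtomisticToContinuum.Crystallization.Theorems.MinMeanCycleStackingLockBarlowEnergyIdentification

/-!
# Crux `PerronTransitivity.NoFractionalGain` (stmt-AtomisticToContinuum-15098), line `merge-perron`:
# K* on the Barlow class from hcp-site domination

The route's foreseen first child of the crux (`BarlowNoFractionalGain`, route file §Two-layer plan: "K* on
the whole Barlow class by Bloch reduction + maximal row sum") in its honest conditional form.  Fix spacings
`a, h > 0` and a periodic stacking sequence `s`; write `X = barlowStacking a h s` (point set of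
`barlowPeriodicConfiguration`).  Every site sum of `X` is `2·barlowSiteEnergy lennardJones a h s m` for the
layer `m` of the site (`tsum_site_barlow_eq`: layer bookkeeping `tsum_points_eq_two_mul_barlowSiteEnergy` +
invariance of site sums under the in-layer lattice translations), and every hcp site sum is `2·e_LJ(hcp a h)`
(`two_mul_barlowSiteEnergy_alternating_eq`).  Hence:

* `perronKepler_on_barlow_subsets_of_hcpSiteDomination` — if `X` is `2^{-1/6}`-separated and NO SITE OF
  `X` IS BOUND BETTER THAN AN hcp SITE at the same spacings
  (`barlowSiteEnergy a h alternatingHagg 0 ≤ barlowSiteEnergy a h s m` for all `m` — "hcp-site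
  domination", the registry statement `J₂ < 0`, `∑_{k≥3}|J_k| ≪ |J₂|` of `BarlowTransitivityLemma` /
  `LjRegistryDomination` read as an inequality on sites), then `X` is a `Λ_hcp`-sub-bound separated
  environment and the landed one-centre regime gives, for every injective finite family `x` of points of `X`
  and ALL real `c`, `2·e_LJ(hcp a h)·∑cᵢ² ≤ ∑_{i≠j} cᵢcⱼV_LJ(dist xᵢ xⱼ)` — the open stub
  `stub_copositiveKepler`'s inequality on the whole Barlow class at spacing `(a, h)`;
* `noFractionalGain_on_barlow_subsets_of_hcpSiteDomination` — and therefore the crux's inequality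
  `2E*·∑cᵢ² ≤ …` there (`E* ≤ e_LJ(hcp a h)`).

Numerically (route file §Cheapest falsifier) the domination margin is `|J₂| ≈ 7·10⁻⁵` per missing
second-neighbour-layer alignment and dhcp's h-sites are bound EXACTLY at the hcp level, so the row-sum route
is the right one for the class (Perron root `<` max row sum `= Λ_hcp`); what it cannot see is everything
non-Barlow, where the open content of K* lives.
-/

noncomputable section

namespace Summit.AtomisticToContinuum.Crystallization.Theorems.PerronTransitivity.NoFractionalGain

open Literature.MathematicalPhysics.StatisticalMechanics
open Summit.AtomisticToContinuum.Crystallization.Theorems (tsum_points_eq_two_mul_barlowSiteEnergy)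
open scoped BigOperators

/-- **Site sums of a periodic configuration are invariant under lattice translations.** [folklore] -/
theorem tsum_site_add_of_mem_lattice (P : PeriodicConfiguration 3) (V : ℝ → ℝ)
    {g : EuclideanSpace ℝ (Fin 3)} (hg : g ∈ P.lattice) (x : EuclideanSpace ℝ (Fin 3)) :
    ∑' q : {q : EuclideanSpace ℝ (Fin 3) // q ∈ P.points ∧ q ≠ x + g}, V (dist (x + g) q.1) =
      ∑' q : {q : EuclideanSpace ℝ (Fin 3) // q ∈ P.points ∧ q ≠ x}, V (dist x q.1) := by
  have hφ : ∀ z, z ∈ P.points ↔ IsometryEquiv.addRight g z ∈ P.points := by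
    intro z
    rw [IsometryEquiv.addRight_apply]
    refine ⟨fun hz => P.add_mem_points hz hg, fun hz => ?_⟩
    have h := P.add_mem_points hz (P.lattice.neg_mem hg)
    simpa using h
  exact tsum_site_eq_of_isometryEquiv P V (IsometryEquiv.addRight g) hφ x

section Barlow

variable {a h : ℝ} {s : ℤ → ℤ} {p : ℕ}

/-- **Every site sum of a periodic Barlow stacking is `2·barlowSiteEnergy` of its layer**: for the site
`barlowPos a h s m i j` (layer `m`, in-layer position `(i, j)`) of `barlowPeriodicConfiguration`, the punctured
Lennard-Jones sum over the stacking equals `2·barlowSiteEnergy lennardJones a h s m` — the in-layer translation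
`i u + j v` is a period, and at `(i, j) = (0, 0)` this is the layer bookkeeping
`tsum_points_eq_two_mul_barlowSiteEnergy`. [folklore] -/
theorem tsum_site_barlow_eq (ha : 0 < a) (hh : 0 < h) (hp : p ≠ 0) (hs : ∀ i, s (i + p) = s i)
    (m i j : ℤ) :
    ∑' q : {q : EuclideanSpace ℝ (Fin 3) //
        q ∈ (barlowPeriodicConfiguration s ha.ne' hh.ne' hp hs).points ∧ q ≠ barlowPos a h s m i j},
      lennardJones (dist (barlowPos a h s m i j) q.1) =
      2 * barlowSiteEnergy lennardJones a h s m := by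
  set g : EuclideanSpace ℝ (Fin 3) := (i : ℝ) • triangularVec₁ a + (j : ℝ) • triangularVec₂ a +
    ((0 : ℤ) : ℝ) • ((haggWindow s 0 p : ℝ) • barlowOffset a + (p : ℝ) • layerNormal h) with hgdef
  have hg : g ∈ (barlowPeriodicConfiguration s ha.ne' hh.ne' hp hs).lattice :=
    sum_smul_mem_barlowPeriodLattice s ha.ne' hh.ne' hp i j 0
  have hpos : barlowPos a h s m i j = barlowPos a h s m 0 0 + g := by
    rw [hgdef, barlowPos_add_sum_smul s hs m 0 0 i j 0]
    simp
  rw [hpos, tsum_site_add_of_mem_lattice _ lennardJones hg,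
    tsum_points_eq_two_mul_barlowSiteEnergy ha hh ha.ne' hh.ne' hp hs m]

/-- **An hcp site sum is `2·e_LJ(hcp a h)`**: `2·barlowSiteEnergy lennardJones a h alternatingHagg 0` equals
twice the energy per particle of `hcpPeriodicConfiguration` (hcp is vertex-transitive:
`SlackRigidityPricedFloorsReadoff.tsum_ne_eq_tsum_ne_zero`, `energyPerParticle_hcp_eq`). [folklore] -/
theorem two_mul_barlowSiteEnergy_alternating_eq (ha : 0 < a) (hh : 0 < h) :
    2 * barlowSiteEnergy lennardJones a h alternatingHagg 0 =
      2 * (hcpPeriodicConfiguration ha.ne' hh.ne').energyPerParticle lennardJones := by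
  have h1 := tsum_points_eq_two_mul_barlowSiteEnergy ha hh ha.ne' hh.ne' two_ne_zero
    alternatingHagg_periodic 0
  have hmem : barlowPos a h alternatingHagg 0 0 0 ∈ (hcpPeriodicConfiguration ha.ne' hh.ne').points := by
    rw [hcpPeriodicConfiguration_points]
    exact ⟨0, 0, 0, rfl⟩
  have h2 := SlackRigidityPricedFloorsReadoff.tsum_ne_eq_tsum_ne_zero ha.ne' hh.ne' hmem
  have h3 := SlackRigidityPricedFloorsReadoff.energyPerParticle_hcp_eq ha.ne' hh.ne'
  rw [← h1]
  change ∑' y : {y : EuclideanSpace ℝ (Fin 3) //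
      y ∈ (hcpPeriodicConfiguration ha.ne' hh.ne').points ∧ y ≠ barlowPos a h alternatingHagg 0 0 0},
      lennardJones (dist (barlowPos a h alternatingHagg 0 0 0) y.1) = _
  rw [h2, h3]
  ring

/-- **The Perron–Kepler bound on the Barlow class from hcp-site domination.**  Let `a, h > 0`, `s` a
`p`-periodic stacking sequence whose Barlow stacking `X = barlowStacking a h s` is `2^{-1/6}`-separated, and
suppose no site of `X` is bound better than an hcp site at the same spacings:
`barlowSiteEnergy a h alternatingHagg 0 ≤ barlowSiteEnergy a h s m` for every layer `m`.  Then for every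
injective finite family `x` of points of `X` and ALL real `c`,
`2·e_LJ(hcp a h)·∑cᵢ² ≤ ∑_{i≠j} cᵢcⱼV_LJ(dist xᵢ xⱼ)`. [folklore] -/
theorem perronKepler_on_barlow_subsets_of_hcpSiteDomination (ha : 0 < a) (hh : 0 < h) (hp : p ≠ 0)
    (hs : ∀ i, s (i + p) = s i)
    (hsepX : ∀ y ∈ barlowStacking a h s, ∀ z ∈ barlowStacking a h s, y ≠ z → (1 : ℝ) / 2 ≤ dist y z ^ 6)
    (hdom : ∀ m : ℤ, barlowSiteEnergy lennardJones a h alternatingHagg 0 ≤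
      barlowSiteEnergy lennardJones a h s m)
    {N : ℕ} (x : Fin N → EuclideanSpace ℝ (Fin 3)) (hx : Function.Injective x)
    (hmem : ∀ i, x i ∈ barlowStacking a h s) (c : Fin N → ℝ) :
    2 * (hcpPeriodicConfiguration ha.ne' hh.ne').energyPerParticle lennardJones * ∑ i, c i ^ 2 ≤
      ∑ i, ∑ j ∈ Finset.univ.erase i, c i * c j * lennardJones (dist (x i) (x j)) := by
  set P := barlowPeriodicConfiguration s ha.ne' hh.ne' hp hs with hPdef
  have hP : P.points = barlowStacking a h s := barlowPeriodicConfiguration_points s ha.ne' hh.ne' hp hs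
  have hsepP : ∀ y ∈ P.points, ∀ z ∈ P.points, y ≠ z → (1 : ℝ) / 2 ≤ dist y z ^ 6 := by
    rw [hP]; exact hsepX
  have hsite : ∀ y ∈ P.points,
      -(-(2 * (hcpPeriodicConfiguration ha.ne' hh.ne').energyPerParticle lennardJones)) ≤
        ∑' q : {q : EuclideanSpace ℝ (Fin 3) // q ∈ P.points ∧ q ≠ y}, lennardJones (dist y q.1) := by
    intro y hy
    rw [hP] at hy
    obtain ⟨m, i, j, rfl⟩ := hy
    rw [neg_neg, hPdef, tsum_site_barlow_eq ha hh hp hs m i j,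
      ← two_mul_barlowSiteEnergy_alternating_eq ha hh]
    linarith [hdom m]
  have hmemP : ∀ i, x i ∈ P.points := fun i => by rw [hP]; exact hmem i
  have h := perronKepler_on_subBound_pieces
    (-(2 * (hcpPeriodicConfiguration ha.ne' hh.ne').energyPerParticle lennardJones)) hsepP
    (fun y _ => P.summable_lennardJones_dist_three y) hsite x hx hmemP c
  simpa using h

/-- **K* on the Barlow class from hcp-site domination** (conditional sub-case of the crux
`PerronTransitivity.NoFractionalGain`, stmt-AtomisticToContinuum-15098): under the hypotheses of
`perronKepler_on_barlow_subsets_of_hcpSiteDomination`, every weighted finite piece of the stacking satisfies the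
crux's inequality `2E*·∑cᵢ² ≤ ∑_{i≠j} cᵢcⱼV_LJ(dist xᵢ xⱼ)` for all real `c` (`E* = ⨅_Q e_LJ(Q) ≤ e_LJ(hcp a h)`).
[folklore] -/
theorem noFractionalGain_on_barlow_subsets_of_hcpSiteDomination : ∀ (a h : ℝ) (ha : 0 < a) (hh : 0 < h)
    (s : ℤ → ℤ) (p : ℕ), p ≠ 0 → (∀ i, s (i + p) = s i) →
    (∀ y ∈ barlowStacking a h s, ∀ z ∈ barlowStacking a h s, y ≠ z → (1 : ℝ) / 2 ≤ dist y z ^ 6) →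
    (∀ m : ℤ, barlowSiteEnergy lennardJones a h alternatingHagg 0 ≤ barlowSiteEnergy lennardJones a h s m) →
    ∀ (N : ℕ) (x : Fin N → EuclideanSpace ℝ (Fin 3)), Function.Injective x →
      (∀ i, x i ∈ barlowStacking a h s) → ∀ c : Fin N → ℝ,
        2 * (⨅ Q : PeriodicConfiguration 3, Q.energyPerParticle lennardJones) * ∑ i, c i ^ 2 ≤
          ∑ i, ∑ j ∈ Finset.univ.erase i, c i * c j * lennardJones (dist (x i) (x j)) := by
  intro a h ha hh s p hp hs hsepX hdom N x hx hmem c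
  have h1 := perronKepler_on_barlow_subsets_of_hcpSiteDomination ha hh hp hs hsepX hdom x hx hmem c
  have h2 : (⨅ Q : PeriodicConfiguration 3, Q.energyPerParticle lennardJones) ≤
      (hcpPeriodicConfiguration ha.ne' hh.ne').energyPerParticle lennardJones :=
    ciInf_le Summit.AtomisticToContinuum.Crystallization.Theorems.ChargedEnergyGapNegative.bddBelow_energyPerParticle_lennardJones _
  have h3 : 0 ≤ ∑ i, c i ^ 2 := Finset.sum_nonneg fun i _ => sq_nonneg (c i)
  have h4 : 2 * (⨅ Q : PeriodicConfiguration 3, Q.energyPerParticle lennardJones) * ∑ i, c i ^ 2 ≤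
      2 * (hcpPeriodicConfiguration ha.ne' hh.ne').energyPerParticle lennardJones * ∑ i, c i ^ 2 :=
    mul_le_mul_of_nonneg_right (by linarith) h3
  exact h4.trans h1

end Barlow

end Summit.AtomisticToContinuum.Crystallization.Theorems.PerronTransitivity.NoFractionalGain

end
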